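import Literature.Probability.RandomPlanarGeometry.LSW2004USTProofs
import Literature.Probability.RandomPlanarGeometry.LoewnerDescriptionProofs
import HarnessLib

/-!
# Simple chordal curves are described by the Loewner evolution

Topic `Literature/Probability/RandomPlanarGeometry` (family `crit-ising`); theorems only, no
definition and no named fact.

G. F. Lawler, *Conformally Invariant Processes in the Plane*, AMS (2005), §4.1, Prop. 4.4 with
Remark 4.5 and p. 96 ("driving function or Loewner transform"): a simple curve `η` in `ℍ ∪ {0}`
from `0` with half-plane capacity `hcap η(0, t] → ∞` can be reparametrised by capacity, and the
maps `g_t` of `ℍ ∖ η(0, t]` then satisfy Loewner's equation with a continuous driving function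
`U_t = g_t(η(t))`, `U_0 = 0`. A. Kemppainen, S. Smirnov, *Random curves, scaling limits and
Loewner evolutions*, Ann. Probab. 45 (2017), §1.2 and App. A.2 ("Let `(W_n(t))` be the driving
term of `γ_n` which exists since `γ_n` is simple"), and D. Chelkak, H. Duminil-Copin,
C. Hongler, A. Kemppainen, S. Smirnov, C. R. Math. 352 (2014), p. 4, use this for the discrete
interfaces transported to a reference domain: each (perturbed, simple) lattice interface in a
Dobrushin domain `(D; a, b)` "can be fully described by the Loewner evolution".

In the tree the ℍ-form is PROVED (`USTPeano.exists_capacity_parametrisation`,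
`LSW2004USTProofs.lean` §Abstract: Lawler's Prop. 4.4 through the function-theoretic slit
theorem `IsPlusSlit.exists_continuous_driving`), and "described by the Loewner evolution through
the chordal uniformizing map `φ` of `(D; a, b)`" is the predicate `IsLoewnerDescribed φ c W`
(`LoewnerDescription.lean`), so far inhabited only by the SLE curves themselves
(`ae_isLoewnerDescribed_sle`). This file PROVES the producer of describability for deterministic
simple curves:

* `MarkedDomain.IsChordalUniformizing.exists_pullbackCurve` — for a curve `c : [0, 1] → ℂ` with
  `c 0 = a`, `c(0, 1) ⊆ D`, injective on `(0, 1)`, the pull-back `η = φ⁻¹ ∘ c` extended by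
  `η 0 = 0` is a simple curve in `ℍ ∪ {0}` on `[0, 1)` (`φ⁻¹ → 0` at `a`, Carathéodory:
  `tendsto_symm_nhds_zero`);
* `exists_orderIso_of_timeChange` — a capacity clock `θ : [0, 1) → [0, ∞)` (continuous,
  strictly increasing, `θ 0 = 0`, `θ → ∞`) compactifies to an increasing homeomorphism `Λ` of
  `[0, 1]` with `rayParam (Λ s) = θ s`;
* **`MarkedDomain.IsChordalUniformizing.exists_isLoewnerDescribed_of_injOn`** — if moreover
  `c 1 = b` and `im φ⁻¹(c(u)) → ∞` as `u ↑ 1` (the curve enters `b = φ(∞)` non-tangentially,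
  so that the capacity diverges — Lawler's hypothesis `b(t) → ∞`), then the class of `c` is
  described through `φ` by a continuous driving function `W` with `W 0 = 0`, and the Loewner
  trace at the capacity time `θ u` of `c[0, u]` is `φ⁻¹(c u)`; corollaries
  `isLoewnerDescribable_mk_of_injOn`, `drivingFunction_mk_apply_zero_of_injOn` (uniqueness of
  the Loewner transform, `IsLoewnerDescribed.driving_unique_holds`);
* `MarkedDomain.IsChordalUniformizing.tendsto_im_symm_IccExtend_atTop_of_segment` — the
  divergence hypothesis for a curve whose final piece is a straight segment `[p, b]` entering
  `b` across a straight piece of `∂D` (lattice interfaces in polygonal lattice domains), from the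
  Schwarz-reflection estimate `tendsto_im_symm_atTop` (`ChordalCapacityDivergence.lean`), and
  the resulting `exists_isLoewnerDescribed_of_segment`;
* `MarkedDomain.IsChordalUniformizing.isLoewnerDescribed_of_capacity_parametrisation'` (and
  the interior version without the prime) — the packaging step in general: any chordal curve
  `c` admitting a capacity clock `θ` and a capacity parametrisation `γ` generating the Loewner
  chain of a continuous `W` and reproducing `c` through the boundary extension of `φ`
  (`Φ (γ (θ u)) = c u`; boundary contact allowed) is described through `φ` by `W` (used for
  LIMITS of simple curves, Kemppainen–Smirnov's Lemma A.4, `LoewnerCurveLimit.lean`).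

## References

* G. F. Lawler, *Conformally Invariant Processes in the Plane*, AMS (2005), §4.1: Prop. 4.4,
  Remark 4.5, p. 96. [Lawler2005]
* A. Kemppainen, S. Smirnov, Ann. Probab. 45 (2017) 698–779 (arXiv:1212.6215), §1.2, App. A.2.
  [KemppainenSmirnov2017]
* D. Chelkak, H. Duminil-Copin, C. Hongler, A. Kemppainen, S. Smirnov, C. R. Math. Acad. Sci.
  Paris 352 (2014) 157–161, p. 4. [CDHKSCRAS2014]
-/

noncomputable section

open Set Function Filter Complex Metric
open _root_.Topology
open UpperHalfPlane (upperHalfPlaneSet)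
open scoped NNReal unitInterval

namespace Literature.Probability.RandomPlanarGeometry

/-! ### Compactifying a capacity clock to a reparametrisation of `[0, 1]` -/

/-- **A divergent clock on `[0, 1)` compactifies to an increasing homeomorphism of `[0, 1]`.**
For `θ : [0, 1) → [0, ∞)` continuous, strictly increasing, `θ 0 = 0`, `θ → ∞` at `1`, there is
an order automorphism `Λ` of `[0, 1]` with `Λ 1 = 1` and `Λ s = θ s / (1 + θ s)`, i.e.
`rayParam (Λ s) = θ s`, for `s < 1`. (Lawler (2005), Remark 4.5: reparametrisation by capacity;
here composed with the time compactification `t ↦ t / (1 + t)` of `IsCompactifiedImage`.)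
[cite: Lawler2005, §4.1 Remark 4.5] -/
theorem exists_orderIso_of_timeChange {θ : ℝ → ℝ≥0} (hθc : ContinuousOn θ (Ico 0 1))
    (hθm : StrictMonoOn θ (Ico 0 1)) (hθ0 : θ 0 = 0) (hθinf : Tendsto θ (𝓝[<] 1) atTop) :
    ∃ Λ : I ≃o I, Λ 1 = 1 ∧ ∀ s : I, (s : ℝ) < 1 → ((Λ s : I) : ℝ) < 1 ∧ rayParam (Λ s) = θ s := by
  classical
  -- the inverse `t ↦ t / (1 + t)` of the time compactification `rayParam s = s / (1 - s)`
  have hri : ∀ t : ℝ≥0, (t : ℝ) / (1 + t) ∈ I := fun t ↦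
    ⟨div_nonneg t.2 (by positivity), (div_le_one (by positivity)).2 (by linarith [t.2])⟩
  set ri : ℝ≥0 → I := fun t ↦ ⟨(t : ℝ) / (1 + t), hri t⟩ with hri_def
  have coe_ri : ∀ t : ℝ≥0, (ri t : ℝ) = (t : ℝ) / (1 + t) := fun t ↦ rfl
  have ri_lt_one : ∀ t : ℝ≥0, (ri t : ℝ) < 1 := fun t ↦ by
    rw [coe_ri, div_lt_one (by positivity)]
    linarith [t.2]
  have rayParam_ri : ∀ t : ℝ≥0, rayParam (ri t) = t := fun t ↦ by
    ext
    rw [coe_rayParam, coe_ri]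
    have h1 : (0 : ℝ) < 1 + t := by positivity
    field_simp
    ring
  have ri_rayParam : ∀ s : I, (s : ℝ) < 1 → ri (rayParam s) = s := fun s hs ↦ by
    ext
    rw [coe_ri, coe_rayParam]
    have h1 : (0 : ℝ) < 1 - s := by linarith
    field_simp
    ring
  have ri_mono : StrictMono ri := by
    intro a b hab
    change (a : ℝ) / (1 + a) < (b : ℝ) / (1 + b)
    have hab' : (a : ℝ) < b := by exact_mod_cast hab
    rw [div_lt_div_iff₀ (by positivity) (by positivity)]
    nlinarith [a.2, b.2]
  set lam : I → I := fun s ↦ if (s : ℝ) < 1 then ri (θ s) else 1 with hlam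
  have hlam_lt : ∀ s : I, (s : ℝ) < 1 → lam s = ri (θ s) := fun s hs ↦ by
    simp only [hlam]
    rw [if_pos hs]
  have hlam_one : ∀ s : I, ¬ (s : ℝ) < 1 → lam s = 1 := fun s hs ↦ by
    simp only [hlam]
    rw [if_neg hs]
  have hmem : ∀ s : I, (s : ℝ) < 1 → (s : ℝ) ∈ Ico (0 : ℝ) 1 := fun s hs ↦ ⟨s.2.1, hs⟩
  -- strict monotonicity
  have hmono : StrictMono lam := by
    intro s s' hss'
    have hss'' : (s : ℝ) < s' := hss'
    have hs1 : (s : ℝ) < 1 := lt_of_lt_of_le hss'' s'.2.2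
    by_cases hs'1 : (s' : ℝ) < 1
    · rw [hlam_lt s hs1, hlam_lt s' hs'1]
      exact ri_mono (hθm (hmem s hs1) (hmem s' hs'1) hss'')
    · rw [hlam_lt s hs1, hlam_one s' hs'1]
      show ri (θ s) < 1
      exact Subtype.coe_lt_coe.1 (by rw [Icc.coe_one]; exact ri_lt_one _)
  -- surjectivity
  have hsurj : Surjective lam := by
    intro y
    by_cases hy : (y : ℝ) < 1
    · -- solve `θ u = rayParam y` on `[0, 1)` by the intermediate value theorem
      set t : ℝ≥0 := rayParam y with ht
      have hev : ∀ᶠ u in 𝓝[<] (1 : ℝ), t ≤ θ u ∧ u ∈ Ioo (0 : ℝ) 1 := by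
        filter_upwards [hθinf.eventually (eventually_ge_atTop t), Ioo_mem_nhdsLT one_pos]
          with u h1 h2
        exact ⟨h1, h2⟩
      obtain ⟨u₁, htu₁, hu₁⟩ := hev.exists
      have hcont : ContinuousOn θ (Icc 0 u₁) := hθc.mono fun x hx ↦ ⟨hx.1, hx.2.trans_lt hu₁.2⟩
      have hIVT := intermediate_value_Icc hu₁.1.le hcont
      rw [hθ0] at hIVT
      obtain ⟨u, hu, hθu⟩ := hIVT ⟨bot_le, htu₁⟩
      have hu1 : u < 1 := hu.2.trans_lt hu₁.2
      refine ⟨⟨u, hu.1, hu1.le⟩, ?_⟩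
      rw [hlam_lt _ hu1]
      change ri (θ u) = y
      rw [hθu, ht, ri_rayParam y hy]
    · refine ⟨1, ?_⟩
      rw [hlam_one 1 (by simp)]
      exact (Subtype.ext (le_antisymm y.2.2 (not_lt.1 hy)) : y = 1).symm
  refine ⟨StrictMono.orderIsoOfSurjective lam hmono hsurj, ?_, fun s hs ↦ ?_⟩
  · change lam 1 = 1
    exact hlam_one 1 (by simp)
  · change ((lam s : I) : ℝ) < 1 ∧ rayParam (lam s) = θ s
    rw [hlam_lt s hs]
    exact ⟨ri_lt_one _, rayParam_ri _⟩

/-! ### The pull-back of a simple chordal curve to `ℍ` -/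

namespace MarkedDomain.IsChordalUniformizing

variable {D : DobrushinDomain} {φ : ConformalEquiv upperHalfPlaneSet D.carrier}

/-- **The pull-back `η = φ⁻¹ ∘ c` of a simple chordal curve.** Let `φ` be a chordal uniformizing
map of `(D; a, b)` and `c : [0, 1] → ℂ` a curve with `c 0 = a`, `c(0, 1) ⊆ D` and injective on
`(0, 1)`. Then `η(u) = φ⁻¹(c(u))` (`0 < u < 1`), `η(0) = 0`, is continuous on `[0, 1)` (at `0`
because `φ⁻¹ → 0` at `a`, Carathéodory), injective on `[0, 1)`, with values in `ℍ` on `(0, 1)`.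
(Lawler (2005), §4.1: the curve "`γ : [0, ∞) → ℍ̄` simple with `γ(0) = 0`, `γ(0, ∞) ⊂ ℍ`" of
Prop. 4.4, obtained by conformal transport.) [cite: Lawler2005, §4.1 Prop. 4.4] -/
theorem exists_pullbackCurve (hφ : D.IsChordalUniformizing φ) {c : Curve ℂ} (h0 : c 0 = D.pt 0)
    (hin : ∀ s : I, 0 < (s : ℝ) → (s : ℝ) < 1 → c s ∈ D.carrier)
    (hinj : InjOn c {s : I | 0 < (s : ℝ) ∧ (s : ℝ) < 1}) :
    ∃ η : ℝ → ℂ, η 0 = 0 ∧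
      (∀ u (hu : u ∈ Ioo (0 : ℝ) 1), η u = φ.symm (c ⟨u, hu.1.le, hu.2.le⟩)) ∧
      (∀ u ∈ Ioo (0 : ℝ) 1, η u = φ.symm (IccExtend zero_le_one c u)) ∧
      (∀ u ∈ Ioo (0 : ℝ) 1, 0 < (η u).im) ∧ ContinuousOn η (Ico 0 1) ∧ InjOn η (Ico 0 1) := by
  classical
  set η : ℝ → ℂ := fun u ↦ if u ≤ 0 then 0 else φ.symm (IccExtend zero_le_one c u) with hη
  have hη0 : η 0 = 0 := by simp [hη]
  have hηext : ∀ u ∈ Ioo (0 : ℝ) 1, η u = φ.symm (IccExtend zero_le_one c u) := fun u hu ↦ by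
    simp [hη, not_le.2 hu.1]
  have hext : ∀ u (hu : u ∈ Ioo (0 : ℝ) 1),
      IccExtend zero_le_one c u = c ⟨u, hu.1.le, hu.2.le⟩ := fun u hu ↦
    IccExtend_of_mem zero_le_one c ⟨hu.1.le, hu.2.le⟩
  have hηeq : ∀ u (hu : u ∈ Ioo (0 : ℝ) 1), η u = φ.symm (c ⟨u, hu.1.le, hu.2.le⟩) :=
    fun u hu ↦ by rw [hηext u hu, hext u hu]
  have hmem : ∀ u (hu : u ∈ Ioo (0 : ℝ) 1), c ⟨u, hu.1.le, hu.2.le⟩ ∈ D.carrier :=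
    fun u hu ↦ hin _ hu.1 hu.2
  have hmem' : ∀ u ∈ Ioo (0 : ℝ) 1, IccExtend zero_le_one c u ∈ D.carrier := fun u hu ↦ by
    rw [hext u hu]; exact hmem u hu
  have hpos : ∀ u ∈ Ioo (0 : ℝ) 1, 0 < (η u).im := fun u hu ↦ by
    rw [hηext u hu]
    exact φ.symm_mapsTo (hmem' u hu)
  have hcext : Continuous fun u : ℝ ↦ IccExtend zero_le_one c u := c.continuous.Icc_extend'
  refine ⟨η, hη0, hηeq, hηext, hpos, ?_, ?_⟩
  · -- continuity on `[0, 1)`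
    intro u hu
    rcases hu.1.eq_or_lt with h00 | h00
    · -- at `0`: `φ⁻¹(c(u)) → 0`
      rw [← h00]
      have hlim := hφ.tendsto_symm_nhds_zero
      have hcurve : Tendsto (fun u : ℝ ↦ IccExtend zero_le_one c u) (𝓝[Ioo (0 : ℝ) 1] 0)
          (𝓝[D.carrier] (D.pt 0)) := by
        refine tendsto_nhdsWithin_of_tendsto_nhds_of_eventually_within _ ?_ ?_
        · have h1 := (hcext.tendsto 0).mono_left (nhdsWithin_le_nhds (s := Ioo (0 : ℝ) 1))
          have h2 : IccExtend zero_le_one c 0 = D.pt 0 := by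
            rw [IccExtend_of_mem zero_le_one c ⟨le_rfl, zero_le_one⟩, ← h0]
            rfl
          rwa [h2] at h1
        · filter_upwards [self_mem_nhdsWithin] with u hu using hmem' u hu
      have h1 : Tendsto η (𝓝[Ioo (0 : ℝ) 1] 0) (𝓝 0) := by
        refine (hlim.comp hcurve).congr' ?_
        filter_upwards [self_mem_nhdsWithin] with u hu using (hηext u hu).symm
      rw [ContinuousWithinAt, hη0, ← Ioo_insert_left one_pos, nhdsWithin_insert, tendsto_sup]
      exact ⟨by rw [← hη0]; exact tendsto_pure_nhds η 0, h1⟩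
    · -- at `u > 0`: locally `φ⁻¹ ∘ c`
      have huI : u ∈ Ioo (0 : ℝ) 1 := ⟨h00, hu.2⟩
      have h1 : ContinuousAt (fun u : ℝ ↦ φ.symm (IccExtend zero_le_one c u)) u :=
        (φ.symm.continuousOn.continuousAt (D.isOpen.mem_nhds (hmem' u huI))).comp
          hcext.continuousAt
      have h2 : η =ᶠ[𝓝 u] fun u : ℝ ↦ φ.symm (IccExtend zero_le_one c u) := by
        filter_upwards [Ioi_mem_nhds h00] with x hx
        simp [hη, not_le.2 (show (0 : ℝ) < x from hx)]
      exact (h1.congr h2.symm).continuousWithinAt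
  · -- injectivity on `[0, 1)`
    intro u hu v hv heq
    rcases hu.1.eq_or_lt with hu0 | hu0 <;> rcases hv.1.eq_or_lt with hv0 | hv0
    · rw [← hu0, ← hv0]
    · exfalso
      have := hpos v ⟨hv0, hv.2⟩
      rw [← heq, ← hu0, hη0, zero_im] at this
      exact lt_irrefl _ this
    · exfalso
      have := hpos u ⟨hu0, hu.2⟩
      rw [heq, ← hv0, hη0, zero_im] at this
      exact lt_irrefl _ this
    · rw [hηeq u ⟨hu0, hu.2⟩, hηeq v ⟨hv0, hv.2⟩] at heq
      have hc := φ.symm.injOn (hmem u ⟨hu0, hu.2⟩) (hmem v ⟨hv0, hv.2⟩) heq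
      have := hinj ⟨hu0, hu.2⟩ ⟨hv0, hv.2⟩ hc
      exact congrArg Subtype.val this

/-! ### Simple chordal curves are described by the Loewner evolution -/

/-- **Simple chordal curves are described by the Loewner evolution** (Lawler (2005), Prop. 4.4
transported to `(D; a, b)`; Kemppainen–Smirnov (2017), App. A.2: "the driving term of `γ_n`
which exists since `γ_n` is simple"; CDHKS (2014), p. 4). Let `φ` be a chordal uniformizing map
of the Dobrushin domain `(D; a, b)` and `c : [0, 1] → ℂ` a curve with `c 0 = a`, `c 1 = b`,
`c(0, 1) ⊆ D`, injective on `(0, 1)`, and such that `im φ⁻¹(c(u)) → +∞` as `u ↑ 1` (the curve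
enters `b = φ(∞)` inside a Stolz sector, so that the half-plane capacity of the pull-back
diverges: Lawler's hypothesis "`b(t) → ∞`" of Prop. 4.4; see
`tendsto_im_symm_IccExtend_atTop_of_segment` for curves ending with a transversal segment). Then
there are a continuous driving function `W` with `W 0 = 0` DESCRIBING the class of `c` through
`φ` (`IsLoewnerDescribed φ (CurveClass.mk c) W`: the chain of `W` is generated by a curve whose
time-compactified `φ`-image ending at `b` is a reparametrisation of `c`) and the capacity clock
`θ : [0, 1) → [0, ∞)` of `c` (continuous, strictly increasing, `θ 0 = 0`, `θ → ∞`) with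
`trace W (θ u) = φ⁻¹(c u)` for `0 < u < 1` (so `hcap φ⁻¹(c(0, u]) = 2 θ(u)`).
[cite: Lawler2005, §4.1 Prop. 4.4 and Remark 4.5] [cite: KemppainenSmirnov2017, App. A.2] -/
theorem exists_isLoewnerDescribed_of_injOn (hφ : D.IsChordalUniformizing φ) {c : Curve ℂ}
    (h0 : c 0 = D.pt 0) (h1 : c 1 = D.pt 1)
    (hin : ∀ s : I, 0 < (s : ℝ) → (s : ℝ) < 1 → c s ∈ D.carrier)
    (hinj : InjOn c {s : I | 0 < (s : ℝ) ∧ (s : ℝ) < 1})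
    (hinf : Tendsto (fun u : ℝ ↦ (φ.symm (IccExtend zero_le_one c u)).im) (𝓝[<] 1) atTop) :
    ∃ (W : ℝ≥0 → ℝ) (θ : ℝ → ℝ≥0), IsLoewnerDescribed φ (CurveClass.mk c) W ∧ W 0 = 0 ∧
      ContinuousOn θ (Ico 0 1) ∧ StrictMonoOn θ (Ico 0 1) ∧ θ 0 = 0 ∧
      Tendsto θ (𝓝[<] 1) atTop ∧
      ∀ u (hu : u ∈ Ioo (0 : ℝ) 1), Loewner.trace W (θ u) = φ.symm (c ⟨u, hu.1.le, hu.2.le⟩) := by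
  obtain ⟨η, hη0, hηeq, hηext, hpos, hηc, hηi⟩ := hφ.exists_pullbackCurve h0 hin hinj
  -- divergence of `im η` at `1`
  have hinf' : Tendsto (fun u ↦ (η u).im) (𝓝[<] 1) atTop := by
    refine hinf.congr' ?_
    filter_upwards [Ioo_mem_nhdsLT one_pos] with u hu
    rw [hηext u hu]
  -- Lawler's Prop. 4.4 in `ℍ` (the tree's slit theorem)
  obtain ⟨θ, γhat, W, hθc, hθm, hθ0, hθinf, hθη, hγ0, -, hWc, hgen⟩ :=
    USTPeano.exists_capacity_parametrisation one_pos hη0 hηc hηi hpos hinf'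
  -- the reparametrisation of `[0, 1]`
  obtain ⟨Λ, hΛ1, hΛ⟩ := exists_orderIso_of_timeChange hθc hθm hθ0 hθinf
  have hW0 : W 0 = 0 := by
    have h := hgen.apply_zero
    rw [hγ0] at h
    exact_mod_cast h.symm
  -- the reparametrised curve is the compactified image of `γhat`
  set c' : Curve ℂ := c.reparam Λ.symm with hc'
  have hI : IsCompactifiedImage φ.boundaryExtension γhat (D.pt 1) c' := by
    constructor
    · intro s hs
      rw [hc', Curve.reparam_apply]
      set u : I := Λ.symm s with hu
      have hΛu : Λ u = s := Λ.apply_symm_apply s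
      have hu1 : (u : ℝ) < 1 := by
        by_contra h
        have hu' : u = 1 := Subtype.ext (le_antisymm u.2.2 (not_lt.1 h))
        rw [hu', hΛ1] at hΛu
        rw [← hΛu] at hs
        simp at hs
      obtain ⟨-, hray⟩ := hΛ u hu1
      rw [hΛu] at hray
      rw [hray]
      rcases u.2.1.eq_or_lt with hu0 | hu0
      · -- `u = 0`: both sides are `a`
        have hu' : u = 0 := Subtype.ext hu0.symm
        rw [hu']
        change c 0 = φ.boundaryExtension (γhat (θ 0))
        rw [hθ0, hγ0, h0]
        exact (φ.boundaryExtension_eq_of_hasBoundaryValue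
          (mem_closure_upperHalfPlaneSet_iff.2 (by simp)) hφ.1).symm
      · -- `0 < u < 1`: `Φ(γhat(θ u)) = φ(φ⁻¹(c u)) = c u`
        have huI : (u : ℝ) ∈ Ioo (0 : ℝ) 1 := ⟨hu0, hu1⟩
        have hmem : c u ∈ D.carrier := hin u hu0 hu1
        rw [hθη u huI, hηeq u huI]
        have heta : (⟨(u : ℝ), huI.1.le, huI.2.le⟩ : I) = u := Subtype.ext rfl
        rw [heta, φ.boundaryExtension_eq (φ.symm_mapsTo hmem), φ.apply_symm_apply hmem]
    · have h := c.target_reparam Λ.symm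
      rw [Curve.target_def, Curve.target_def] at h
      rw [hc', h, h1]
  have hdesc : IsLoewnerDescribed φ (CurveClass.mk c) W :=
    ⟨hWc, γhat, hgen, c', (CurveClass.mk_reparam c Λ.symm).symm, hI⟩
  have htrace : Loewner.trace W = γhat := Loewner.IsGeneratedByCurve.trace_eq_holds hWc hgen
  refine ⟨W, θ, hdesc, hW0, hθc, hθm, hθ0, hθinf, fun u hu ↦ ?_⟩
  rw [htrace, hθη u hu, hηeq u hu]

/-- **Simple chordal curves are Loewner-describable** (`IsLoewnerDescribable`), under the
hypotheses of `exists_isLoewnerDescribed_of_injOn`. [cite: Lawler2005, §4.1 Prop. 4.4]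
[cite: CDHKSCRAS2014, p. 4] -/
theorem isLoewnerDescribable_mk_of_injOn (hφ : D.IsChordalUniformizing φ) {c : Curve ℂ}
    (h0 : c 0 = D.pt 0) (h1 : c 1 = D.pt 1)
    (hin : ∀ s : I, 0 < (s : ℝ) → (s : ℝ) < 1 → c s ∈ D.carrier)
    (hinj : InjOn c {s : I | 0 < (s : ℝ) ∧ (s : ℝ) < 1})
    (hinf : Tendsto (fun u : ℝ ↦ (φ.symm (IccExtend zero_le_one c u)).im) (𝓝[<] 1) atTop) :
    IsLoewnerDescribable φ (CurveClass.mk c) := by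
  obtain ⟨W, -, hW, -⟩ := hφ.exists_isLoewnerDescribed_of_injOn h0 h1 hin hinj hinf
  exact hW.isLoewnerDescribable

/-- **The Loewner transform of a simple chordal curve starts at `0`**: under the hypotheses of
`exists_isLoewnerDescribed_of_injOn`, `drivingFunction φ (CurveClass.mk c) 0 = 0` (the
describing function is unique, `IsLoewnerDescribed.driving_unique_holds`, and the one constructed
has `W 0 = 0` because the pull-back starts at `φ⁻¹(a) = 0`). [cite: Lawler2005, §4.1 p. 96] -/
theorem drivingFunction_mk_apply_zero_of_injOn (hφ : D.IsChordalUniformizing φ) {c : Curve ℂ}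
    (h0 : c 0 = D.pt 0) (h1 : c 1 = D.pt 1)
    (hin : ∀ s : I, 0 < (s : ℝ) → (s : ℝ) < 1 → c s ∈ D.carrier)
    (hinj : InjOn c {s : I | 0 < (s : ℝ) ∧ (s : ℝ) < 1})
    (hinf : Tendsto (fun u : ℝ ↦ (φ.symm (IccExtend zero_le_one c u)).im) (𝓝[<] 1) atTop) :
    drivingFunction φ (CurveClass.mk c) 0 = 0 := by
  obtain ⟨W, -, hW, hW0, -⟩ := hφ.exists_isLoewnerDescribed_of_injOn h0 h1 hin hinj hinf
  rw [hW.drivingFunction_eq IsLoewnerDescribed.driving_unique_holds hφ, hW0]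

/-- **The Loewner trace of a simple chordal curve, read through the capacity clock**: under the
hypotheses of `exists_isLoewnerDescribed_of_injOn` there is a clock `θ` (continuous, strictly
increasing on `[0, 1)`, `θ 0 = 0`, `θ → ∞`) with
`trace (drivingFunction φ (CurveClass.mk c)) (θ u) = φ⁻¹(c u)` for `0 < u < 1`.
[cite: Lawler2005, §4.1 Prop. 4.4 and Remark 4.5] -/
theorem exists_trace_drivingFunction_mk_eq_of_injOn (hφ : D.IsChordalUniformizing φ)
    {c : Curve ℂ} (h0 : c 0 = D.pt 0) (h1 : c 1 = D.pt 1)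
    (hin : ∀ s : I, 0 < (s : ℝ) → (s : ℝ) < 1 → c s ∈ D.carrier)
    (hinj : InjOn c {s : I | 0 < (s : ℝ) ∧ (s : ℝ) < 1})
    (hinf : Tendsto (fun u : ℝ ↦ (φ.symm (IccExtend zero_le_one c u)).im) (𝓝[<] 1) atTop) :
    ∃ θ : ℝ → ℝ≥0, ContinuousOn θ (Ico 0 1) ∧ StrictMonoOn θ (Ico 0 1) ∧ θ 0 = 0 ∧
      Tendsto θ (𝓝[<] 1) atTop ∧
      ∀ u (hu : u ∈ Ioo (0 : ℝ) 1),
        Loewner.trace (drivingFunction φ (CurveClass.mk c)) (θ u) =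
          φ.symm (c ⟨u, hu.1.le, hu.2.le⟩) := by
  obtain ⟨W, θ, hW, -, hθc, hθm, hθ0, hθinf, htr⟩ :=
    hφ.exists_isLoewnerDescribed_of_injOn h0 h1 hin hinj hinf
  refine ⟨θ, hθc, hθm, hθ0, hθinf, fun u hu ↦ ?_⟩
  rw [hW.drivingFunction_eq IsLoewnerDescribed.driving_unique_holds hφ, htr u hu]

/-! ### The divergence hypothesis for a curve ending with a transversal segment -/

/-- **Capacity divergence for a curve entering `b` along a segment across a straight piece of
boundary.** Let `φ` be a chordal uniformizing map of `(D; a, b)`; suppose the open half-disc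
`b + ρ (B(0, r) ∩ ℍ)` lies in `D` and its diameter `b + ρ (-r, r)` lies on `∂D ∖ {a}`
(`ρ ≠ 0`), and that near `u = 1` the curve is `c(u) = b + ρ τ(u) d` with `im d > 0` and
`τ(u) ↓ 0`. Then `im φ⁻¹(c(u)) → +∞` as `u ↑ 1` (`tendsto_im_symm_atTop`: Schwarz reflection).
This is the hypothesis `hinf` of `exists_isLoewnerDescribed_of_injOn` for lattice interfaces,
which reach the target along a lattice edge transversal to the boundary ([LSW04] Thm. 4.4 set-up;
Lawler (2005), Prop. 4.4: "`b(t) → ∞`"). [cite: Lawler2005, §4.1 Prop. 4.4] -/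
theorem tendsto_im_symm_IccExtend_atTop (hφ : D.IsChordalUniformizing φ) {c : Curve ℂ}
    {ρ d : ℂ} (hρ : ρ ≠ 0) {r : ℝ} (hr : 0 < r)
    (hball : ∀ z : ℂ, ‖z‖ < r → 0 < z.im → D.pt 1 + ρ * z ∈ D.carrier)
    (hfr : ∀ x : ℝ, |x| < r → D.pt 1 + ρ * x ∈ frontier D.carrier)
    (hne : ∀ x : ℝ, |x| < r → D.pt 1 + ρ * x ≠ D.pt 0) (hd : 0 < d.im) {τ : ℝ → ℝ}
    (hτ : Tendsto τ (𝓝[<] 1) (𝓝[>] 0))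
    (hc : ∀ᶠ u in 𝓝[<] (1 : ℝ), IccExtend zero_le_one c u = D.pt 1 + ρ * (τ u * d)) :
    Tendsto (fun u : ℝ ↦ (φ.symm (IccExtend zero_le_one c u)).im) (𝓝[<] 1) atTop := by
  have key := (hφ.tendsto_im_symm_atTop hρ hr hball hfr hne hd).comp hτ
  refine key.congr' ?_
  filter_upwards [hc] with u hu
  simp only [Function.comp_apply]
  rw [hu]

/-- **Capacity divergence for a curve whose final piece is the segment `[p, b]`.** If, for some
parameter `s₀ < 1`, `c(u) = p + ((u - s₀)/(1 - s₀)) (b - p)` for `s₀ ≤ u ≤ 1`, where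
`p = b + ρ w` with `im w > 0`, `‖w‖ < r`, and the half-disc `b + ρ (B(0, r) ∩ ℍ)` lies in `D`
with diameter on `∂D ∖ {a}`, then `im φ⁻¹(c(u)) → +∞` as `u ↑ 1`.
[cite: Lawler2005, §4.1 Prop. 4.4] -/
theorem tendsto_im_symm_IccExtend_atTop_of_segment (hφ : D.IsChordalUniformizing φ)
    {c : Curve ℂ} {ρ w : ℂ} (hρ : ρ ≠ 0) {r : ℝ} (hr : 0 < r)
    (hball : ∀ z : ℂ, ‖z‖ < r → 0 < z.im → D.pt 1 + ρ * z ∈ D.carrier)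
    (hfr : ∀ x : ℝ, |x| < r → D.pt 1 + ρ * x ∈ frontier D.carrier)
    (hne : ∀ x : ℝ, |x| < r → D.pt 1 + ρ * x ≠ D.pt 0) (hw : 0 < w.im) {s₀ : ℝ} (hs₀0 : 0 ≤ s₀)
    (hs₀ : s₀ < 1)
    (hseg : ∀ u (hu : u ∈ Icc s₀ 1),
      c ⟨u, hs₀0.trans hu.1, hu.2⟩ =
        (D.pt 1 + ρ * w) + (((u - s₀) / (1 - s₀) : ℝ) : ℂ) * (D.pt 1 - (D.pt 1 + ρ * w))) :
    Tendsto (fun u : ℝ ↦ (φ.symm (IccExtend zero_le_one c u)).im) (𝓝[<] 1) atTop := by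
  -- `c(u) = b + ρ τ(u) w` with `τ(u) = (1 - u)/(1 - s₀) ↓ 0`
  have h1s : (0 : ℝ) < 1 - s₀ := by linarith
  refine hφ.tendsto_im_symm_IccExtend_atTop hρ hr hball hfr hne hw
    (τ := fun u ↦ (1 - u) / (1 - s₀)) ?_ ?_
  · refine tendsto_nhdsWithin_of_tendsto_nhds_of_eventually_within _ ?_ ?_
    · have hcont : Continuous fun u : ℝ ↦ (1 - u) / (1 - s₀) := by fun_prop
      have h := hcont.tendsto 1
      rw [sub_self, zero_div] at h
      exact h.mono_left nhdsWithin_le_nhds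
    · filter_upwards [self_mem_nhdsWithin] with u hu
      exact div_pos (by simpa using hu) h1s
  · filter_upwards [Ioo_mem_nhdsLT hs₀] with u hu
    have huI : u ∈ Icc (0 : ℝ) 1 := ⟨hs₀0.trans hu.1.le, hu.2.le⟩
    rw [IccExtend_of_mem zero_le_one c huI]
    have h := hseg u ⟨hu.1.le, hu.2.le⟩
    have heta : (⟨u, hs₀0.trans hu.1.le, hu.2.le⟩ : I) = ⟨u, huI⟩ := rfl
    rw [heta] at h
    rw [h]
    have h2 : (((u - s₀) / (1 - s₀) : ℝ) : ℂ) = 1 - (((1 - u) / (1 - s₀) : ℝ) : ℂ) := by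
      have : (u - s₀) / (1 - s₀) = 1 - (1 - u) / (1 - s₀) := by
        field_simp
        ring
      rw [this]
      push_cast
      ring
    rw [h2]
    ring

/-- **Simple chordal curves ending with a transversal segment are described by the Loewner
evolution**: the combination of `exists_isLoewnerDescribed_of_injOn` and
`tendsto_im_symm_IccExtend_atTop_of_segment` (the form met by simple lattice interfaces in a
polygonal lattice domain whose target `b` is an interior point of a boundary edge).
[cite: Lawler2005, §4.1 Prop. 4.4] [cite: KemppainenSmirnov2017, App. A.2] [cite: CDHKSCRAS2014, p. 4] -/
theorem exists_isLoewnerDescribed_of_segment (hφ : D.IsChordalUniformizing φ) {c : Curve ℂ}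
    (h0 : c 0 = D.pt 0) (h1 : c 1 = D.pt 1)
    (hin : ∀ s : I, 0 < (s : ℝ) → (s : ℝ) < 1 → c s ∈ D.carrier)
    (hinj : InjOn c {s : I | 0 < (s : ℝ) ∧ (s : ℝ) < 1})
    {ρ w : ℂ} (hρ : ρ ≠ 0) {r : ℝ} (hr : 0 < r)
    (hball : ∀ z : ℂ, ‖z‖ < r → 0 < z.im → D.pt 1 + ρ * z ∈ D.carrier)
    (hfr : ∀ x : ℝ, |x| < r → D.pt 1 + ρ * x ∈ frontier D.carrier)
    (hne : ∀ x : ℝ, |x| < r → D.pt 1 + ρ * x ≠ D.pt 0) (hw : 0 < w.im) {s₀ : ℝ} (hs₀0 : 0 ≤ s₀)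
    (hs₀ : s₀ < 1)
    (hseg : ∀ u (hu : u ∈ Icc s₀ 1),
      c ⟨u, hs₀0.trans hu.1, hu.2⟩ =
        (D.pt 1 + ρ * w) + (((u - s₀) / (1 - s₀) : ℝ) : ℂ) * (D.pt 1 - (D.pt 1 + ρ * w))) :
    ∃ (W : ℝ≥0 → ℝ) (θ : ℝ → ℝ≥0), IsLoewnerDescribed φ (CurveClass.mk c) W ∧ W 0 = 0 ∧
      ContinuousOn θ (Ico 0 1) ∧ StrictMonoOn θ (Ico 0 1) ∧ θ 0 = 0 ∧
      Tendsto θ (𝓝[<] 1) atTop ∧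
      ∀ u (hu : u ∈ Ioo (0 : ℝ) 1), Loewner.trace W (θ u) = φ.symm (c ⟨u, hu.1.le, hu.2.le⟩) :=
  hφ.exists_isLoewnerDescribed_of_injOn h0 h1 hin hinj
    (hφ.tendsto_im_symm_IccExtend_atTop_of_segment hρ hr hball hfr hne hw hs₀0 hs₀ hseg)


/-! ### Describability from a capacity parametrisation -/

/-- **A chordal curve with a capacity parametrisation is described by the Loewner evolution**
(boundary contact allowed). Let `φ` be a chordal uniformizing map of `(D; a, b)` with
boundary extension `Φ`, and `c : [0, 1] → ℂ` a curve with `c 0 = a`, `c 1 = b`. Suppose a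
clock `θ : [0, 1) → [0, ∞)` (continuous, strictly increasing, `θ 0 = 0`, `θ → ∞`) and a curve
`γ : [0, ∞) → ℂ` with `γ 0 = 0` generate the chordal Loewner chain of a continuous `W`
(`Loewner.IsGeneratedByCurve W γ`) and reproduce `c` through `Φ`: `Φ (γ (θ u)) = c u` for
`0 < u < 1` (for simple `c` inside `D` these are the data of `exists_isLoewnerDescribed_of_injOn`;
for limits of such curves, which may touch `∂D`, those of Kemppainen–Smirnov's main lemma,
Lemma A.4). Then the class of `c` is described through `φ` by `W`: the time-compactified
`Φ`-image of `γ` ending at `b` is the reparametrisation of `c` by the compactified clock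
(`exists_orderIso_of_timeChange`). [cite: Lawler2005, §4.1 Remark 4.5]
[cite: KemppainenSmirnov2017, App. A Lemma A.4] [cite: CDHKSCRAS2014, p. 4] -/
theorem isLoewnerDescribed_of_capacity_parametrisation' (hφ : D.IsChordalUniformizing φ)
    {c : Curve ℂ} (h0 : c 0 = D.pt 0) (h1 : c 1 = D.pt 1)
    {θ : ℝ → ℝ≥0} (hθc : ContinuousOn θ (Ico 0 1)) (hθm : StrictMonoOn θ (Ico 0 1))
    (hθ0 : θ 0 = 0) (hθinf : Tendsto θ (𝓝[<] 1) atTop) {γ : ℝ≥0 → ℂ} {W : ℝ≥0 → ℝ}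
    (hW : Continuous W) (hgen : Loewner.IsGeneratedByCurve W γ) (hγ0 : γ 0 = 0)
    (hγθ : ∀ u (hu : u ∈ Ioo (0 : ℝ) 1),
      φ.boundaryExtension (γ (θ u)) = c ⟨u, hu.1.le, hu.2.le⟩) :
    IsLoewnerDescribed φ (CurveClass.mk c) W := by
  obtain ⟨Λ, hΛ1, hΛ⟩ := exists_orderIso_of_timeChange hθc hθm hθ0 hθinf
  set c' : Curve ℂ := c.reparam Λ.symm with hc'
  have hI : IsCompactifiedImage φ.boundaryExtension γ (D.pt 1) c' := by
    constructor
    · intro s hs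
      rw [hc', Curve.reparam_apply]
      set u : I := Λ.symm s with hu
      have hΛu : Λ u = s := Λ.apply_symm_apply s
      have hu1 : (u : ℝ) < 1 := by
        by_contra h
        have hu' : u = 1 := Subtype.ext (le_antisymm u.2.2 (not_lt.1 h))
        rw [hu', hΛ1] at hΛu
        rw [← hΛu] at hs
        simp at hs
      obtain ⟨-, hray⟩ := hΛ u hu1
      rw [hΛu] at hray
      rw [hray]
      rcases u.2.1.eq_or_lt with hu0 | hu0
      · have hu' : u = 0 := Subtype.ext hu0.symm
        rw [hu']
        change c 0 = φ.boundaryExtension (γ (θ 0))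
        rw [hθ0, hγ0, h0]
        exact (φ.boundaryExtension_eq_of_hasBoundaryValue
          (mem_closure_upperHalfPlaneSet_iff.2 (by simp)) hφ.1).symm
      · have huI : (u : ℝ) ∈ Ioo (0 : ℝ) 1 := ⟨hu0, hu1⟩
        rw [hγθ u huI]
    · have h := c.target_reparam Λ.symm
      rw [Curve.target_def, Curve.target_def] at h
      rw [hc', h, h1]
  exact ⟨hW, γ, hgen, c', (CurveClass.mk_reparam c Λ.symm).symm, hI⟩

/-- **A chordal curve inside `D` with a capacity parametrisation is described by the Loewner
evolution**: the case of `isLoewnerDescribed_of_capacity_parametrisation'` where `c(0, 1) ⊆ D`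
and the parametrisation reproduces the pull-back, `γ (θ u) = φ⁻¹(c u)`.
[cite: Lawler2005, §4.1 Remark 4.5] [cite: KemppainenSmirnov2017, App. A Lemma A.4] -/
theorem isLoewnerDescribed_of_capacity_parametrisation (hφ : D.IsChordalUniformizing φ)
    {c : Curve ℂ} (h0 : c 0 = D.pt 0) (h1 : c 1 = D.pt 1)
    (hin : ∀ s : I, 0 < (s : ℝ) → (s : ℝ) < 1 → c s ∈ D.carrier)
    {θ : ℝ → ℝ≥0} (hθc : ContinuousOn θ (Ico 0 1)) (hθm : StrictMonoOn θ (Ico 0 1))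
    (hθ0 : θ 0 = 0) (hθinf : Tendsto θ (𝓝[<] 1) atTop) {γ : ℝ≥0 → ℂ} {W : ℝ≥0 → ℝ}
    (hW : Continuous W) (hgen : Loewner.IsGeneratedByCurve W γ) (hγ0 : γ 0 = 0)
    (hγθ : ∀ u (hu : u ∈ Ioo (0 : ℝ) 1), γ (θ u) = φ.symm (c ⟨u, hu.1.le, hu.2.le⟩)) :
    IsLoewnerDescribed φ (CurveClass.mk c) W := by
  refine hφ.isLoewnerDescribed_of_capacity_parametrisation' h0 h1 hθc hθm hθ0 hθinf hW hgen hγ0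
    fun u hu ↦ ?_
  have hmem : c ⟨u, hu.1.le, hu.2.le⟩ ∈ D.carrier := hin _ hu.1 hu.2
  rw [hγθ u hu, φ.boundaryExtension_eq (φ.symm_mapsTo hmem), φ.apply_symm_apply hmem]

/-- Under the hypotheses of `isLoewnerDescribed_of_capacity_parametrisation'`, the describing
function starts at `0` (`γ 0 = W 0`). [folklore] -/
theorem apply_zero_eq_zero_of_isGeneratedByCurve {γ : ℝ≥0 → ℂ} {W : ℝ≥0 → ℝ}
    (hgen : Loewner.IsGeneratedByCurve W γ) (hγ0 : γ 0 = 0) : W 0 = 0 := by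
  have h := hgen.apply_zero
  rw [hγ0] at h
  exact_mod_cast h.symm

end MarkedDomain.IsChordalUniformizing

end Literature.Probability.RandomPlanarGeometry
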